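import Literature.Analysis.FluidPDE.FluidComputer.ThresholdLevelPass
import HarnessLib

/-!
# Stages 1–2 of the threshold gate under forcing: the TUBE STEP (soundness layer)

HONEST FRAMING: low prior, high value-of-information experiment on Tao's machine paradigm; NOT a
claim that NS blows up.

The level machinery of `ThresholdLevelPass`/`ThresholdLevelStep` (the trigger `c` as the clock of the
bookkeeping) only runs AFTER the trigger has ignited (`νb ≥ μa`).  Before that — the quiet
pre-threshold stage and the threshold crossing of the circuit
`thresholdCircuit ε σ ν μ r κ` (`ThresholdGate.lean`) driven by a forcing of sup-norm `≤ δ`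
(`IsForcedWindow`) — the trigger is slaved and tiny, and the bookkeeping has to march in TIME.
This file is the soundness layer of that time-marching: ONE TUBE STEP of length `h`.

The tube cross-section (`TubeBox`) is a product of intervals for the carrier `a = X 0`, the clock
`b = X 1` and the trigger `c = X 2`, and an ELLIPSE `2(d - d̄)² + (ã - z̄)² ≤ V` for the rotor pair
(conduit `d = X 3`, output `ã = X 4`) around a reference point `(d̄, z̄)`.  Along the step the
reference point moves on an explicit quadratic (Taylor-2) curve `d̄(t) = d̄₀ + s₁t + s₂t²`,
`z̄(t) = z̄₀ + u₁t + u₂t²`; the weighted distance `V(t) = 2(d - d̄(t))² + (ã - z̄(t))²` then obeys the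
EXACT identity
`V̇ = -4κ z̄ e_d² + 4e_d(D_d + f₃) + 2e_z(D_z + f₄) - 2κ e_d² e_z`
(`e_d = d - d̄`, `e_z = ã - z̄`, `f` the forcing, `D_d = r·a·c - κ z̄ d̄ - d̄'`, `D_z = κ d̄² - z̄'` the
defects of the reference curve): the rotation `ḋ ∋ -κ d ã`, `ã' = κd²` CANCELS in this weighting, the
output `z̄ > 0` DAMPS the conduit error, and only the reference defects, the forcing and a cubic
remainder drive `V`.  The carrier / clock / trigger are propagated by centred Grönwall envelopes
(`Literature.Analysis.ODE.OneSidedComparison`).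

`TubeStep.Valid` lists, as plain real inequalities, what a step certificate has to establish (an
a-priori region closing STRICTLY under the Euler bounds and under the `V`-growth bound, the defect
bounds of the reference, the centred rate brackets, and the exit box); `TubeStep.tube_step` is the
theorem: a forced window entering the step in the entry box stays in the a-priori region for the
whole step and leaves it in the exit box.  The proof is a continuous induction
(`persist_lt`, the pattern of `nonneg_persist`) followed by the one-sided comparison lemmas.  The
dyadic checker that DISCHARGES `Valid` by interval arithmetic is `TubeCheck.lean`; the certified
run of the design point is `TubeTable*.lean` / `TubeCertificate.lean`.
-/

noncomputable section

open Set Filter Topology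

namespace Literature.Analysis.FluidPDE.FluidComputer

open Literature.Analysis.FluidPDE.Tao2016AveragedNS Literature.Analysis.ODE

/-! ### Continuous induction: closed under limits, open under strictness -/

/-- **Persistence** (continuous induction on `[0, τ]`): a property holding at `0`, closed under
left limits, and — whenever it has held on `[0, s]` — holding on a neighbourhood of `s`, holds on
the whole window. [folklore] -/
theorem persist_of_open_closed {P : ℝ → Prop} {τ : ℝ} (hτ : 0 ≤ τ) (h0 : P 0)
    (hclosed : ∀ t ∈ Ioc 0 τ, (∀ s ∈ Ico 0 t, P s) → P t)
    (hopen : ∀ s ∈ Ico 0 τ, (∀ t ∈ Icc 0 s, P t) → ∀ᶠ t in 𝓝[Icc 0 τ] s, P t) :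
    ∀ t ∈ Icc 0 τ, P t := by
  have hTmem : maximalTimeP P 0 τ ∈ Icc 0 τ := maximalTimeP_mem hτ h0
  have hPT : ∀ t ∈ Icc 0 (maximalTimeP P 0 τ), P t :=
    fun t ht => maximalTimeP_spec hτ h0 hclosed ht
  have hTeq : maximalTimeP P 0 τ = τ := by
    by_contra hne
    have hlt : maximalTimeP P 0 τ < τ := lt_of_le_of_ne hTmem.2 hne
    exact not_eventually_of_maximalTimeP_lt hτ h0 hlt (hopen _ ⟨hTmem.1, hlt⟩ hPT)
  intro t ht
  exact hPT t (by rw [hTeq]; exact ht)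

/-! ### The tube cross-section and the step data -/

/-- **Tube cross-section**: intervals for carrier, clock and trigger; an ellipse
`2(d - dc)² + (ã - zc)² ≤ V` for the rotor pair. [folklore] -/
structure TubeBox where
  /-- carrier interval -/
  al : ℝ
  ah : ℝ
  /-- clock interval -/
  bl : ℝ
  bh : ℝ
  /-- trigger interval -/
  cl : ℝ
  ch : ℝ
  /-- centre of the rotor ellipse: conduit, output -/
  dc : ℝ
  zc : ℝ
  /-- size of the rotor ellipse -/
  V : ℝ

/-- Membership of a mode vector in a tube cross-section. [folklore] -/
def TubeBox.mem (B : TubeBox) (X : Fin 5 → ℝ) : Prop :=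
  (B.al ≤ X 0 ∧ X 0 ≤ B.ah) ∧ (B.bl ≤ X 1 ∧ X 1 ≤ B.bh) ∧ (B.cl ≤ X 2 ∧ X 2 ≤ B.ch) ∧
    2 * (X 3 - B.dc) ^ 2 + (X 4 - B.zc) ^ 2 ≤ B.V

/-- **Step data** (all of it CHOSEN by the checker; soundness holds for any choice satisfying
`Valid`): step length, static a-priori box for `(a, b, c, d)` and output range, ellipse radii,
reference-curve coefficients, naive rate bounds, defect bounds, the `V`-growth constant, centring
rates and centred brackets. [folklore] -/
structure TubeStep where
  /-- step length -/
  h : ℝ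
  /-- a-priori carrier / clock / trigger / conduit / output ranges over the step -/
  Al : ℝ
  Ah : ℝ
  Bl : ℝ
  Bh : ℝ
  Cl : ℝ
  Ch : ℝ
  Dl : ℝ
  Dh : ℝ
  Zl : ℝ
  Zh : ℝ
  /-- radii: `|d - d̄| ≤ rd` and `2e_d² + e_z² ≤ rb²` along the step -/
  rd : ℝ
  rb : ℝ
  /-- reference curve `d̄(t) = dc + s1 t + s2 t²`, `z̄(t) = zc + u1 t + u2 t²` -/
  s1 : ℝ
  s2 : ℝ
  u1 : ℝ
  u2 : ℝ
  /-- naive bounds of the forced rates of `a, b, c` on the a-priori box (forcing included) -/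
  Fal : ℝ
  Fah : ℝ
  Fbl : ℝ
  Fbh : ℝ
  Fcl : ℝ
  Fch : ℝ
  /-- bounds of `|D_d| + δ` and `|D_z| + δ` -/
  A : ℝ
  Bz : ℝ
  /-- bound of `V̇` -/
  Kp : ℝ
  /-- centring rates and centred brackets (forcing included) for the exit envelopes -/
  la : ℝ
  lb : ℝ
  lc : ℝ
  Eal : ℝ
  Eah : ℝ
  Ebl : ℝ
  Ebh : ℝ
  Ecl : ℝ
  Ech : ℝ

namespace TubeStep

variable (S : TubeStep)

/-- reference conduit `d̄(t)` [folklore] -/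
def dbar (B : TubeBox) (t : ℝ) : ℝ := B.dc + S.s1 * t + S.s2 * t ^ 2
/-- reference output `z̄(t)` [folklore] -/
def zbar (B : TubeBox) (t : ℝ) : ℝ := B.zc + S.u1 * t + S.u2 * t ^ 2
/-- `d̄'(t)` [folklore] -/
def dbar' (t : ℝ) : ℝ := S.s1 + 2 * S.s2 * t
/-- `z̄'(t)` [folklore] -/
def zbar' (t : ℝ) : ℝ := S.u1 + 2 * S.u2 * t

/-- The static a-priori box for `(a, b, c, d)`. [folklore] -/
def box (X : Fin 5 → ℝ) : Prop :=
  (S.Al ≤ X 0 ∧ X 0 ≤ S.Ah) ∧ (S.Bl ≤ X 1 ∧ X 1 ≤ S.Bh) ∧ (S.Cl ≤ X 2 ∧ X 2 ≤ S.Ch) ∧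
    (S.Dl ≤ X 3 ∧ X 3 ≤ S.Dh)

/-- The moving a-priori region at time `t` of the step. [folklore] -/
def region (B : TubeBox) (t : ℝ) (X : Fin 5 → ℝ) : Prop :=
  (S.Al ≤ X 0 ∧ X 0 ≤ S.Ah) ∧ (S.Bl ≤ X 1 ∧ X 1 ≤ S.Bh) ∧ (S.Cl ≤ X 2 ∧ X 2 ≤ S.Ch) ∧
    2 * (X 3 - S.dbar B t) ^ 2 + (X 4 - S.zbar B t) ^ 2 ≤ S.rb ^ 2

/-- The bound of the damped quadratic `-4κ z̄ e² + 4A|e|` over `|e| ≤ rd`, `z̄ ≥ Zb`. [folklore] -/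
def phiBound (κ Zb A rd : ℝ) : ℝ :=
  if 0 < Zb then
    (if A ≤ 2 * κ * Zb * rd then A ^ 2 / (κ * Zb) else 4 * A * rd - 4 * κ * Zb * rd ^ 2)
  else 4 * κ * (-Zb) * rd ^ 2 + 4 * A * rd

/-- [folklore] -/
theorem phi_le {κ Zb A rd e z : ℝ} (hκ : 0 < κ) (hA : 0 ≤ A) (he : |e| ≤ rd) (hz : Zb ≤ z) :
    -4 * κ * z * e ^ 2 + 4 * A * |e| ≤ phiBound κ Zb A rd := by
  have hu0 : 0 ≤ |e| := abs_nonneg e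
  have hrd : 0 ≤ rd := hu0.trans he
  have he2 : e ^ 2 = |e| ^ 2 := (sq_abs e).symm
  have hmono : -4 * κ * z * e ^ 2 ≤ -4 * κ * Zb * e ^ 2 := by
    have := mul_nonneg (mul_nonneg (sub_nonneg.2 hz) hκ.le) (sq_nonneg e)
    nlinarith [this]
  rw [he2] at hmono ⊢
  set u := |e| with hu
  unfold phiBound
  split_ifs with hZb hcase
  · -- vertex value bounds the concave quadratic everywhere
    have hkz : 0 < κ * Zb := mul_pos hκ hZb
    have key : -4 * κ * Zb * u ^ 2 + 4 * A * u ≤ A ^ 2 / (κ * Zb) := by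
      rw [le_div_iff₀ hkz]
      nlinarith [sq_nonneg (2 * κ * Zb * u - A)]
    linarith
  · push Not at hcase
    have h1 : 0 ≤ rd - u := sub_nonneg.2 he
    have h2 : 0 ≤ A - κ * Zb * (rd + u) := by
      have : κ * Zb * (rd + u) ≤ κ * Zb * (2 * rd) :=
        mul_le_mul_of_nonneg_left (by linarith) (mul_pos hκ hZb).le
      linarith
    have key : -4 * κ * Zb * u ^ 2 + 4 * A * u ≤ 4 * A * rd - 4 * κ * Zb * rd ^ 2 := by
      have := mul_nonneg h1 h2
      nlinarith [this]
    linarith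
  · push Not at hZb
    have h1 : -4 * κ * Zb * u ^ 2 ≤ 4 * κ * (-Zb) * rd ^ 2 := by
      have hu2 : u ^ 2 ≤ rd ^ 2 := pow_le_pow_left₀ hu0 he 2
      have := mul_le_mul_of_nonneg_left hu2
        (mul_nonneg (mul_nonneg (by norm_num : (0:ℝ) ≤ 4) hκ.le) (neg_nonneg.2 hZb))
      linarith
    have h2 : 4 * A * u ≤ 4 * A * rd := mul_le_mul_of_nonneg_left he (by linarith)
    linarith

/-- **What a step certificate establishes.** [folklore] -/
structure Valid (G : GateData) (S : TubeStep) (B B' : TubeBox) : Prop where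
  h_nonneg : 0 ≤ S.h
  rd_nonneg : 0 ≤ S.rd
  rb_nonneg : 0 ≤ S.rb
  rb_sq_le : S.rb ^ 2 ≤ 2 * S.rd ^ 2
  A_nonneg : 0 ≤ S.A
  Bz_nonneg : 0 ≤ S.Bz
  Kp_nonneg : 0 ≤ S.Kp
  /-- strict entry -/
  a0 : S.Al < B.al ∧ B.ah < S.Ah
  b0 : S.Bl < B.bl ∧ B.bh < S.Bh
  c0 : S.Cl < B.cl ∧ B.ch < S.Ch
  V0 : B.V < S.rb ^ 2
  /-- the reference curve inside the a-priori conduit / output data -/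
  ref : ∀ t ∈ Icc 0 S.h, S.Dl + S.rd ≤ S.dbar B t ∧ S.dbar B t + S.rd ≤ S.Dh ∧
    S.Zl + S.rb ≤ S.zbar B t ∧ S.zbar B t + S.rb ≤ S.Zh
  /-- naive rate enclosures on the box -/
  Fa : ∀ X, S.box X → S.Fal + G.δ ≤ thresholdCircuit G.ε G.σ G.ν G.μ G.r G.κ X 0 ∧
    thresholdCircuit G.ε G.σ G.ν G.μ G.r G.κ X 0 ≤ S.Fah - G.δ
  Fb : ∀ X, S.box X → S.Fbl + G.δ ≤ thresholdCircuit G.ε G.σ G.ν G.μ G.r G.κ X 1 ∧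
    thresholdCircuit G.ε G.σ G.ν G.μ G.r G.κ X 1 ≤ S.Fbh - G.δ
  Fc : ∀ X, S.box X → S.Fcl + G.δ ≤ thresholdCircuit G.ε G.σ G.ν G.μ G.r G.κ X 2 ∧
    thresholdCircuit G.ε G.σ G.ν G.μ G.r G.κ X 2 ≤ S.Fch - G.δ
  /-- strict Euler inclusion at the far end of the step -/
  Ea : S.Al < B.al + S.h * S.Fal ∧ B.ah + S.h * S.Fah < S.Ah
  Eb : S.Bl < B.bl + S.h * S.Fbl ∧ B.bh + S.h * S.Fbh < S.Bh
  Ec : S.Cl < B.cl + S.h * S.Fcl ∧ B.ch + S.h * S.Fch < S.Ch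
  /-- defect bounds of the reference curve -/
  dA : ∀ t ∈ Icc 0 S.h, ∀ X, S.box X →
    |G.r * X 0 * X 2 - G.κ * S.zbar B t * S.dbar B t - S.dbar' t| + G.δ ≤ S.A
  dB : ∀ t ∈ Icc 0 S.h, |G.κ * S.dbar B t ^ 2 - S.zbar' t| + G.δ ≤ S.Bz
  /-- the growth constant of `V` -/
  Kp : phiBound G.κ (S.Zl + S.rb) S.A S.rd + 2 * S.rb * S.Bz + 2 * G.κ * S.rd ^ 2 * S.rb ≤ S.Kp
  /-- the ellipse closes strictly -/
  boot : B.V + S.h * S.Kp < S.rb ^ 2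
  /-- centred brackets on the box -/
  Ga : ∀ X, S.box X →
    S.Eal + G.δ ≤ thresholdCircuit G.ε G.σ G.ν G.μ G.r G.κ X 0 - S.la * X 0 ∧
    thresholdCircuit G.ε G.σ G.ν G.μ G.r G.κ X 0 - S.la * X 0 ≤ S.Eah - G.δ
  Gb : ∀ X, S.box X →
    S.Ebl + G.δ ≤ thresholdCircuit G.ε G.σ G.ν G.μ G.r G.κ X 1 - S.lb * X 1 ∧
    thresholdCircuit G.ε G.σ G.ν G.μ G.r G.κ X 1 - S.lb * X 1 ≤ S.Ebh - G.δ
  Gc : ∀ X, S.box X →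
    S.Ecl + G.δ ≤ thresholdCircuit G.ε G.σ G.ν G.μ G.r G.κ X 2 - S.lc * X 2 ∧
    thresholdCircuit G.ε G.σ G.ν G.μ G.r G.κ X 2 - S.lc * X 2 ≤ S.Ech - G.δ
  /-- the exit box contains the envelopes -/
  a1 : B'.al ≤ -gronwallBound (-B.al) S.la (-S.Eal) S.h ∧ gronwallBound B.ah S.la S.Eah S.h ≤ B'.ah
  b1 : B'.bl ≤ -gronwallBound (-B.bl) S.lb (-S.Ebl) S.h ∧ gronwallBound B.bh S.lb S.Ebh S.h ≤ B'.bh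
  c1 : B'.cl ≤ -gronwallBound (-B.cl) S.lc (-S.Ecl) S.h ∧ gronwallBound B.ch S.lc S.Ech S.h ≤ B'.ch
  dc1 : B'.dc = S.dbar B S.h
  zc1 : B'.zc = S.zbar B S.h
  V1 : B.V + S.h * S.Kp ≤ B'.V

variable {S}

/-- A point of the moving region lies in the static box, within `rd` of the reference conduit and
within `rb` of the reference output. [folklore] -/
theorem box_of_region {G : GateData} {B B' : TubeBox} (hV : S.Valid G B B') {t : ℝ}
    (ht : t ∈ Icc 0 S.h) {X : Fin 5 → ℝ} (hX : S.region B t X) :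
    S.box X ∧ |X 3 - S.dbar B t| ≤ S.rd ∧ |X 4 - S.zbar B t| ≤ S.rb ∧
      S.Zl ≤ X 4 ∧ X 4 ≤ S.Zh := by
  obtain ⟨ha, hb, hc, hE⟩ := hX
  obtain ⟨h1, h2, h3, h4⟩ := hV.ref t ht
  have hd2 : (X 3 - S.dbar B t) ^ 2 ≤ S.rd ^ 2 := by
    nlinarith [sq_nonneg (X 4 - S.zbar B t), hV.rb_sq_le]
  have hz2 : (X 4 - S.zbar B t) ^ 2 ≤ S.rb ^ 2 := by
    nlinarith [sq_nonneg (X 3 - S.dbar B t)]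
  have hd := abs_le_of_sq_le_sq' hd2 hV.rd_nonneg
  have hz := abs_le_of_sq_le_sq' hz2 hV.rb_nonneg
  refine ⟨⟨ha, hb, hc, ?_, ?_⟩, abs_le.2 hd, abs_le.2 hz, ?_, ?_⟩ <;> linarith [hd.1, hd.2, hz.1, hz.2]

/-- [folklore] -/
theorem hasDerivAt_dbar (B : TubeBox) (t : ℝ) : HasDerivAt (S.dbar B) (S.dbar' t) t := by
  have h2 : HasDerivAt (fun x : ℝ => x ^ 2) (2 * t) t := by simpa using hasDerivAt_pow 2 t
  have h := (((hasDerivAt_id' t).const_mul S.s1).const_add B.dc).add (h2.const_mul S.s2)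
  have e : S.s1 * 1 + S.s2 * (2 * t) = S.dbar' t := by simp only [dbar']; ring
  rw [e] at h
  exact h

/-- [folklore] -/
theorem hasDerivAt_zbar (B : TubeBox) (t : ℝ) : HasDerivAt (S.zbar B) (S.zbar' t) t := by
  have h2 : HasDerivAt (fun x : ℝ => x ^ 2) (2 * t) t := by simpa using hasDerivAt_pow 2 t
  have h := (((hasDerivAt_id' t).const_mul S.u1).const_add B.zc).add (h2.const_mul S.u2)
  have e : S.u1 * 1 + S.u2 * (2 * t) = S.zbar' t := by simp only [zbar']; ring
  rw [e] at h
  exact h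

/-- [folklore] -/
theorem continuous_dbar (B : TubeBox) : Continuous (S.dbar B) := by
  unfold dbar; fun_prop

/-- [folklore] -/
theorem continuous_zbar (B : TubeBox) : Continuous (S.zbar B) := by
  unfold zbar; fun_prop

/-- **The bounds on a sub-window** on which the region is known: Euler bounds, the `V`-growth
bound and the centred Grönwall envelopes, all at the end `s` of the sub-window. [folklore] -/
theorem bounds_of_region {G : GateData} (hG : G.Valid) {B B' : TubeBox} (hV : S.Valid G B B')
    {y : ℝ → Fin 5 → ℝ} (hW : IsForcedWindow G.ε G.σ G.ν G.μ G.r G.κ G.δ S.h y)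
    (h0 : B.mem (y 0)) {s : ℝ} (hs : s ∈ Icc 0 S.h)
    (hreg : ∀ t ∈ Ico 0 s, S.region B t (y t)) :
    (B.al + s * S.Fal ≤ y s 0 ∧ y s 0 ≤ B.ah + s * S.Fah) ∧
    (B.bl + s * S.Fbl ≤ y s 1 ∧ y s 1 ≤ B.bh + s * S.Fbh) ∧
    (B.cl + s * S.Fcl ≤ y s 2 ∧ y s 2 ≤ B.ch + s * S.Fch) ∧
    2 * (y s 3 - S.dbar B s) ^ 2 + (y s 4 - S.zbar B s) ^ 2 ≤ B.V + s * S.Kp ∧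
    (-gronwallBound (-B.al) S.la (-S.Eal) s ≤ y s 0 ∧ y s 0 ≤ gronwallBound B.ah S.la S.Eah s) ∧
    (-gronwallBound (-B.bl) S.lb (-S.Ebl) s ≤ y s 1 ∧ y s 1 ≤ gronwallBound B.bh S.lb S.Ebh s) ∧
    (-gronwallBound (-B.cl) S.lc (-S.Ecl) s ≤ y s 2 ∧ y s 2 ≤ gronwallBound B.ch S.lc S.Ech s) := by
  have hWs := hW.mono hs.2
  choose! W hW' hWδ using hWs.defect
  have hcn : ∀ i, ContinuousOn (fun t => y t i) (Icc 0 s) := fun i =>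
    (continuous_apply i).comp_continuousOn hWs.continuousOn
  have hdv : ∀ i, ∀ t ∈ Ico 0 s, HasDerivWithinAt (fun t => y t i) (W t i) (Ici t) t :=
    fun i t ht => (hasDerivWithinAt_pi.1 (hW' t ht)) i
  have hdf : ∀ i, ∀ t ∈ Ico 0 s,
      |W t i - thresholdCircuit G.ε G.σ G.ν G.μ G.r G.κ (y t) i| ≤ G.δ := fun i t ht => by
    have := abs_apply_le_of_norm_le (hWδ t ht) i
    rwa [Pi.sub_apply] at this
  have hbox : ∀ t ∈ Ico 0 s, S.box (y t) ∧ |y t 3 - S.dbar B t| ≤ S.rd ∧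
      |y t 4 - S.zbar B t| ≤ S.rb ∧ S.Zl ≤ y t 4 ∧ y t 4 ≤ S.Zh := fun t ht =>
    box_of_region hV ⟨ht.1, ht.2.le.trans hs.2⟩ (hreg t ht)
  obtain ⟨⟨ha0l, ha0h⟩, ⟨hb0l, hb0h⟩, ⟨hc0l, hc0h⟩, hV00⟩ := h0
  -- Euler and Grönwall bounds for one coordinate
  have coord : ∀ (i : Fin 5) (Fl Fh lam El Eh x0l x0h : ℝ), x0l ≤ y 0 i → y 0 i ≤ x0h →
      (∀ X, S.box X → Fl + G.δ ≤ thresholdCircuit G.ε G.σ G.ν G.μ G.r G.κ X i ∧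
        thresholdCircuit G.ε G.σ G.ν G.μ G.r G.κ X i ≤ Fh - G.δ) →
      (∀ X, S.box X → El + G.δ ≤ thresholdCircuit G.ε G.σ G.ν G.μ G.r G.κ X i - lam * X i ∧
        thresholdCircuit G.ε G.σ G.ν G.μ G.r G.κ X i - lam * X i ≤ Eh - G.δ) →
      (x0l + s * Fl ≤ y s i ∧ y s i ≤ x0h + s * Fh) ∧
      (-gronwallBound (-x0l) lam (-El) s ≤ y s i ∧ y s i ≤ gronwallBound x0h lam Eh s) := by
    intro i Fl Fh lam El Eh x0l x0h hx0l hx0h hF hE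
    have hup : ∀ t ∈ Ico 0 s, W t i ≤ Fh := fun t ht => by
      have h1 := (abs_le.1 (hdf i t ht)).2; have h2 := (hF _ (hbox t ht).1).2; linarith
    have hlo : ∀ t ∈ Ico 0 s, Fl ≤ W t i := fun t ht => by
      have h1 := (abs_le.1 (hdf i t ht)).1; have h2 := (hF _ (hbox t ht).1).1; linarith
    have hgu : ∀ t ∈ Ico 0 s, W t i ≤ lam * y t i + Eh := fun t ht => by
      have h1 := (abs_le.1 (hdf i t ht)).2; have h2 := (hE _ (hbox t ht).1).2; linarith
    have hgl : ∀ t ∈ Ico 0 s, lam * y t i - (-El) ≤ W t i := fun t ht => by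
      have h1 := (abs_le.1 (hdf i t ht)).1; have h2 := (hE _ (hbox t ht).1).1; linarith
    have hsI : s ∈ Icc 0 s := ⟨hs.1, le_rfl⟩
    have e1 := sub_le_mul_of_deriv_right_le (hcn i) (hdv i) hup s hsI
    have e2 := mul_le_sub_of_le_deriv_right (hcn i) (hdv i) hlo s hsI
    have e3 := le_gronwallBound_of_deriv_right_le (hcn i) (hdv i) hgu s hsI
    have e4 := gronwallBound_neg_le_of_le_deriv_right (hcn i) (hdv i) hgl s hsI
    rw [sub_zero] at e1 e2 e3 e4
    refine ⟨⟨by linarith, by linarith⟩, ?_, ?_⟩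
    · refine le_trans ?_ e4
      have := gronwallBound_mono_init lam (-El) s (neg_le_neg hx0l)
      linarith
    · exact e3.trans (gronwallBound_mono_init lam Eh s hx0h)
  have cA := coord 0 S.Fal S.Fah S.la S.Eal S.Eah B.al B.ah ha0l ha0h hV.Fa hV.Ga
  have cB := coord 1 S.Fbl S.Fbh S.lb S.Ebl S.Ebh B.bl B.bh hb0l hb0h hV.Fb hV.Gb
  have cC := coord 2 S.Fcl S.Fch S.lc S.Ecl S.Ech B.cl B.ch hc0l hc0h hV.Fc hV.Gc
  refine ⟨cA.1, cB.1, cC.1, ?_, cA.2, cB.2, cC.2⟩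
  -- the ellipse
  obtain ⟨Vf, hVf⟩ : ∃ Vf : ℝ → ℝ, ∀ t,
      Vf t = 2 * (y t 3 - S.dbar B t) ^ 2 + (y t 4 - S.zbar B t) ^ 2 := ⟨_, fun _ => rfl⟩
  obtain ⟨Vd, hVd⟩ : ∃ Vd : ℝ → ℝ, ∀ t, Vd t = 4 * (y t 3 - S.dbar B t) * (W t 3 - S.dbar' t) +
      2 * (y t 4 - S.zbar B t) * (W t 4 - S.zbar' t) := ⟨_, fun _ => rfl⟩
  have hVcn : ContinuousOn Vf (Icc 0 s) := by
    have h3 := (hcn 3).sub (S.continuous_dbar B).continuousOn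
    have h4 := (hcn 4).sub (S.continuous_zbar B).continuousOn
    exact (((h3.pow 2).const_smul (2 : ℝ)).add (h4.pow 2)).congr (fun t _ => by
      rw [hVf]; simp [smul_eq_mul])
  have hVdv : ∀ t ∈ Ico 0 s, HasDerivWithinAt Vf (Vd t) (Ici t) t := by
    intro t ht
    have h3 : HasDerivWithinAt (fun t => y t 3 - S.dbar B t) (W t 3 - S.dbar' t) (Ici t) t :=
      (hdv 3 t ht).sub (S.hasDerivAt_dbar B t).hasDerivWithinAt
    have h4 : HasDerivWithinAt (fun t => y t 4 - S.zbar B t) (W t 4 - S.zbar' t) (Ici t) t :=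
      (hdv 4 t ht).sub (S.hasDerivAt_zbar B t).hasDerivWithinAt
    have h := ((h3.mul h3).const_mul (2 : ℝ)).add (h4.mul h4)
    have e : Vf = fun t => 2 * ((y t 3 - S.dbar B t) * (y t 3 - S.dbar B t)) +
        (y t 4 - S.zbar B t) * (y t 4 - S.zbar B t) := by
      funext t; rw [hVf]; ring
    rw [e]
    exact h.congr_deriv (by rw [hVd]; ring)
  have hVbd : ∀ t ∈ Ico 0 s, Vd t ≤ S.Kp := by
    intro t ht
    obtain ⟨hbx, hed, hez, -, -⟩ := hbox t ht
    have htI : t ∈ Icc 0 S.h := ⟨ht.1, ht.2.le.trans hs.2⟩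
    obtain ⟨-, -, hZb, -⟩ := hV.ref t htI
    have hg3 := hdf 3 t ht
    have hg4 := hdf 4 t ht
    rw [thresholdCircuit_apply_three] at hg3
    rw [thresholdCircuit_apply_four] at hg4
    set ed := y t 3 - S.dbar B t with hed_def
    set ez := y t 4 - S.zbar B t with hez_def
    set f3 := W t 3 - (G.r * y t 0 * y t 2 - G.κ * y t 3 * y t 4) with hf3
    set f4 := W t 4 - G.κ * y t 3 ^ 2 with hf4
    set Dd := G.r * y t 0 * y t 2 - G.κ * S.zbar B t * S.dbar B t - S.dbar' t with hDd
    set Dz := G.κ * S.dbar B t ^ 2 - S.zbar' t with hDz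
    have hident : Vd t = 4 * ed * (Dd + f3) + 2 * ez * (Dz + f4) -
        4 * G.κ * S.zbar B t * ed ^ 2 - 2 * G.κ * ed ^ 2 * ez := by
      have e3 : y t 3 = S.dbar B t + ed := by rw [hed_def]; ring
      have e4 : y t 4 = S.zbar B t + ez := by rw [hez_def]; ring
      rw [hVd, hf3, hf4, hDd, hDz, hed_def, hez_def]
      ring
    have hA := hV.dA t htI _ hbx
    have hBz := hV.dB t htI
    have hDf3 : |Dd + f3| ≤ S.A := (abs_add_le _ _).trans (by linarith)
    have hDf4 : |Dz + f4| ≤ S.Bz := (abs_add_le _ _).trans (by linarith)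
    have t1 : 4 * ed * (Dd + f3) ≤ 4 * S.A * |ed| := by
      have : ed * (Dd + f3) ≤ |ed| * S.A := by
        have h := abs_mul ed (Dd + f3)
        have := mul_le_mul_of_nonneg_left hDf3 (abs_nonneg ed)
        linarith [le_abs_self (ed * (Dd + f3))]
      linarith
    have t2 : 2 * ez * (Dz + f4) ≤ 2 * S.rb * S.Bz := by
      have : ez * (Dz + f4) ≤ |ez| * S.Bz := by
        have h := abs_mul ez (Dz + f4)
        have := mul_le_mul_of_nonneg_left hDf4 (abs_nonneg ez)
        linarith [le_abs_self (ez * (Dz + f4))]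
      have h2 : |ez| * S.Bz ≤ S.rb * S.Bz := mul_le_mul_of_nonneg_right hez hV.Bz_nonneg
      linarith
    have t3 : -4 * G.κ * S.zbar B t * ed ^ 2 + 4 * S.A * |ed| ≤
        phiBound G.κ (S.Zl + S.rb) S.A S.rd := phi_le hG.hκ hV.A_nonneg hed hZb
    have t4 : -(2 * G.κ * ed ^ 2 * ez) ≤ 2 * G.κ * S.rd ^ 2 * S.rb := by
      have h1 : ed ^ 2 ≤ S.rd ^ 2 := by
        have := pow_le_pow_left₀ (abs_nonneg ed) hed 2; rwa [sq_abs] at this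
      have h2 : ed ^ 2 * (-ez) ≤ ed ^ 2 * |ez| :=
        mul_le_mul_of_nonneg_left (neg_le_abs ez) (sq_nonneg ed)
      have h3 : ed ^ 2 * |ez| ≤ S.rd ^ 2 * S.rb := mul_le_mul h1 hez (abs_nonneg ez) (sq_nonneg S.rd)
      have h4 := mul_le_mul_of_nonneg_left (h2.trans h3) (mul_nonneg (by norm_num : (0:ℝ) ≤ 2) hG.hκ.le)
      linarith
    rw [hident]
    linarith [hV.Kp]
  have hsI : s ∈ Icc 0 s := ⟨hs.1, le_rfl⟩
  have e := sub_le_mul_of_deriv_right_le hVcn hVdv hVbd s hsI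
  have hV0' : Vf 0 ≤ B.V := by
    rw [hVf]; simp only [dbar, zbar]; simpa using hV00
  rw [sub_zero] at e
  rw [← hVf]
  linarith

/-- **The tube step.**  A forced window of length `h` that enters the step in the entry box `B`
stays in the moving a-priori region on `[0, h]` and leaves in the exit box `B'`. [folklore] -/
theorem tube_step {G : GateData} (hG : G.Valid) {B B' : TubeBox} (hV : S.Valid G B B')
    {y : ℝ → Fin 5 → ℝ} (hW : IsForcedWindow G.ε G.σ G.ν G.μ G.r G.κ G.δ S.h y)
    (h0 : B.mem (y 0)) :
    (∀ t ∈ Icc 0 S.h, S.region B t (y t)) ∧ B'.mem (y S.h) := by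
  have hcn : ∀ i, ContinuousOn (fun t => y t i) (Icc 0 S.h) := fun i =>
    (continuous_apply i).comp_continuousOn hW.continuousOn
  obtain ⟨Vf, hVf⟩ : ∃ Vf : ℝ → ℝ, ∀ t,
      Vf t = 2 * (y t 3 - S.dbar B t) ^ 2 + (y t 4 - S.zbar B t) ^ 2 := ⟨_, fun _ => rfl⟩
  have hVcn : ContinuousOn Vf (Icc 0 S.h) := by
    have h3 := (hcn 3).sub (S.continuous_dbar B).continuousOn
    have h4 := (hcn 4).sub (S.continuous_zbar B).continuousOn
    exact (((h3.pow 2).const_smul (2 : ℝ)).add (h4.pow 2)).congr (fun t _ => by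
      rw [hVf]; simp [smul_eq_mul])
  have hregion_iff : ∀ t, S.region B t (y t) ↔
      (S.Al ≤ y t 0 ∧ y t 0 ≤ S.Ah) ∧ (S.Bl ≤ y t 1 ∧ y t 1 ≤ S.Bh) ∧
      (S.Cl ≤ y t 2 ∧ y t 2 ≤ S.Ch) ∧ Vf t ≤ S.rb ^ 2 := fun t => by rw [hVf]; exact Iff.rfl
  obtain ⟨⟨ha0l, ha0h⟩, ⟨hb0l, hb0h⟩, ⟨hc0l, hc0h⟩, hV00⟩ := h0
  have h0' : B.mem (y 0) := ⟨⟨ha0l, ha0h⟩, ⟨hb0l, hb0h⟩, ⟨hc0l, hc0h⟩, hV00⟩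
  have hVf0 : Vf 0 ≤ B.V := by rw [hVf]; simp only [dbar, zbar]; simpa using hV00
  -- continuous induction
  have hreg : ∀ t ∈ Icc 0 S.h, S.region B t (y t) := by
    refine persist_of_open_closed (P := fun t => S.region B t (y t)) hV.h_nonneg ?_ ?_ ?_
    · rw [hregion_iff]
      exact ⟨⟨by linarith [hV.a0.1], by linarith [hV.a0.2]⟩,
        ⟨by linarith [hV.b0.1], by linarith [hV.b0.2]⟩,
        ⟨by linarith [hV.c0.1], by linarith [hV.c0.2]⟩, by linarith [hV.V0]⟩
    · intro t ht hP
      have lim : ∀ (g : ℝ → ℝ) (C : ℝ), ContinuousOn g (Icc 0 S.h) →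
          (∀ s ∈ Ico 0 t, g s ≤ C) → g t ≤ C := fun g C hg hs =>
        le_const_of_forall_Ico (C := C) hg ht hs
      have hP' : ∀ s ∈ Ico 0 t, (S.Al ≤ y s 0 ∧ y s 0 ≤ S.Ah) ∧ (S.Bl ≤ y s 1 ∧ y s 1 ≤ S.Bh) ∧
          (S.Cl ≤ y s 2 ∧ y s 2 ≤ S.Ch) ∧ Vf s ≤ S.rb ^ 2 := fun s hs => (hregion_iff s).1 (hP s hs)
      rw [hregion_iff]
      refine ⟨⟨?_, lim _ _ (hcn 0) fun s hs => (hP' s hs).1.2⟩,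
        ⟨?_, lim _ _ (hcn 1) fun s hs => (hP' s hs).2.1.2⟩,
        ⟨?_, lim _ _ (hcn 2) fun s hs => (hP' s hs).2.2.1.2⟩,
        lim _ _ hVcn fun s hs => (hP' s hs).2.2.2⟩
      · have := lim (fun s => -y s 0) (-S.Al) (hcn 0).neg fun s hs => by
          have := (hP' s hs).1.1; linarith
        linarith
      · have := lim (fun s => -y s 1) (-S.Bl) (hcn 1).neg fun s hs => by
          have := (hP' s hs).2.1.1; linarith
        linarith
      · have := lim (fun s => -y s 2) (-S.Cl) (hcn 2).neg fun s hs => by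
          have := (hP' s hs).2.2.1.1; linarith
        linarith
    · intro s hs hle
      have hsI : s ∈ Icc 0 S.h := ⟨hs.1, hs.2.le⟩
      obtain ⟨hA, hB, hC, hVs, -, -, -⟩ :=
        bounds_of_region hG hV hW h0' hsI (fun t ht => hle t ⟨ht.1, ht.2.le⟩)
      have hs0 := hs.1
      have hsh : s ≤ S.h := hs.2.le
      -- strict bounds at `s` (affine in `s`: between the values at `0` and at `h`)
      have sa1 : S.Al < y s 0 := by
        by_cases hF : 0 ≤ S.Fal
        · linarith [hV.a0.1, hA.1, mul_nonneg hs0 hF]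
        · have := mul_nonneg (sub_nonneg.2 hsh) (neg_nonneg.2 (le_of_lt (not_le.1 hF)))
          linarith [hV.Ea.1, hA.1]
      have sa2 : y s 0 < S.Ah := by
        by_cases hF : 0 ≤ S.Fah
        · have := mul_nonneg (sub_nonneg.2 hsh) hF
          linarith [hV.Ea.2, hA.2]
        · have := mul_nonneg hs0 (neg_nonneg.2 (le_of_lt (not_le.1 hF)))
          linarith [hV.a0.2, hA.2]
      have sb1 : S.Bl < y s 1 := by
        by_cases hF : 0 ≤ S.Fbl
        · linarith [hV.b0.1, hB.1, mul_nonneg hs0 hF]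
        · have := mul_nonneg (sub_nonneg.2 hsh) (neg_nonneg.2 (le_of_lt (not_le.1 hF)))
          linarith [hV.Eb.1, hB.1]
      have sb2 : y s 1 < S.Bh := by
        by_cases hF : 0 ≤ S.Fbh
        · have := mul_nonneg (sub_nonneg.2 hsh) hF
          linarith [hV.Eb.2, hB.2]
        · have := mul_nonneg hs0 (neg_nonneg.2 (le_of_lt (not_le.1 hF)))
          linarith [hV.b0.2, hB.2]
      have sc1 : S.Cl < y s 2 := by
        by_cases hF : 0 ≤ S.Fcl
        · linarith [hV.c0.1, hC.1, mul_nonneg hs0 hF]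
        · have := mul_nonneg (sub_nonneg.2 hsh) (neg_nonneg.2 (le_of_lt (not_le.1 hF)))
          linarith [hV.Ec.1, hC.1]
      have sc2 : y s 2 < S.Ch := by
        by_cases hF : 0 ≤ S.Fch
        · have := mul_nonneg (sub_nonneg.2 hsh) hF
          linarith [hV.Ec.2, hC.2]
        · have := mul_nonneg hs0 (neg_nonneg.2 (le_of_lt (not_le.1 hF)))
          linarith [hV.c0.2, hC.2]
      have sV : Vf s < S.rb ^ 2 := by
        have := mul_nonneg (sub_nonneg.2 hsh) hV.Kp_nonneg
        have hVs' : Vf s ≤ B.V + s * S.Kp := by rw [hVf]; exact hVs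
        linarith [hV.boot]
      -- hence on a neighbourhood of `s` within the window
      have cw : ∀ i, ContinuousWithinAt (fun t => y t i) (Icc 0 S.h) s := fun i => hcn i s hsI
      have e1 := (cw 0).eventually_const_lt sa1
      have e2 := (cw 0).eventually_lt_const sa2
      have e3 := (cw 1).eventually_const_lt sb1
      have e4 := (cw 1).eventually_lt_const sb2
      have e5 := (cw 2).eventually_const_lt sc1
      have e6 := (cw 2).eventually_lt_const sc2
      have e7 := (hVcn s hsI).eventually_lt_const sV
      filter_upwards [e1, e2, e3, e4, e5, e6, e7] with t t1 t2 t3 t4 t5 t6 t7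
      rw [hregion_iff]
      exact ⟨⟨t1.le, t2.le⟩, ⟨t3.le, t4.le⟩, ⟨t5.le, t6.le⟩, t7.le⟩
  refine ⟨hreg, ?_⟩
  have hhI : S.h ∈ Icc 0 S.h := ⟨hV.h_nonneg, le_rfl⟩
  obtain ⟨-, -, -, hVs, hA, hB, hC⟩ :=
    bounds_of_region hG hV hW h0' hhI (fun t ht => hreg t ⟨ht.1, ht.2.le⟩)
  refine ⟨⟨hV.a1.1.trans hA.1, hA.2.trans hV.a1.2⟩, ⟨hV.b1.1.trans hB.1, hB.2.trans hV.b1.2⟩,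
    ⟨hV.c1.1.trans hC.1, hC.2.trans hV.c1.2⟩, ?_⟩
  rw [hV.dc1, hV.zc1]
  exact hVs.trans hV.V1

end TubeStep

end Literature.Analysis.FluidPDE.FluidComputer
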